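import Summits.BirchSwinnertonDyer.BirchSwinnertonDyer.Theorems.QuadraticBranchSignedControlPlusEtaNonsurjThetaFunctionalEquationNormCoordinate
import Summits.BirchSwinnertonDyer.BirchSwinnertonDyer.Theorems.QuadraticBranchSignedControlPlusEtaNonsurjThetaFunctionalEquationReciprocity
import Summits.BirchSwinnertonDyer.BirchSwinnertonDyer.Theorems.QuadraticBranchSignedControlPlusEtaNonsurjThetaFunctionalEquationSubleading
import HarnessLib

/-!
# Route `QuadraticBranchSignedControl` (rung K8, cell `bsd-potss`), residual crux `PlusEtaMainConjectureNonsurj`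
# (stmt-BirchSwinnertonDyer-19606): THE FUNCTIONAL EQUATION ON THE QUADRATIC BRANCH, XXIV — THE NORM-COORDINATE FORM OF EVERY
# SOLUTION OF `ι M = w·(1+T)^e·M`: **`M = (1+T)^{−e/2} · S^{ord M} · N(Z)`**, `S = T(1+T)^{−1/2}`, `Z = T + ιT = T²/(1+T)`, `N(0) ≠ 0`;
# `Λ = ℤ_p⟦Z⟧ ⊕ S·ℤ_p⟦Z⟧`; for every `L_p^±(V, η, X)`: **`L = p^μ · P · (1+T)^{−(e+λ)/2} · E(Z)`**, `E(0) ∈ ℤ_pˣ`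
# (seat `bsd-potss-k8eta-c2` g30; kernel, class-wide, fact-free)

WHY. Part XXIII showed that the Iwasawa involution `ι` of `Λ = ℤ_p⟦T⟧` (`p` odd) is the sign change `S ↦ −S` in the coordinate
`S = T(1+T)^r`, `2r = −1`, with fixed ring `ℤ_p⟦Z⟧`, `Z = S² = T + ιT`. THIS FILE turns g28's census rationale P-28E («`M = (1+T)^{−e/2}·D^r·
N(T²/(1+T))`», verified there numerically on 9125 + 44 + 138 rows, never proved) into theorems: (§67) `Λ = ℤ_p⟦Z⟧ ⊕ S·ℤ_p⟦Z⟧` (unique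
decomposition); (§68) EVERY solution of `ι M = (1+T)^e·M` is `M = (1+T)^{e r}·N(Z)` (`e r = −e/2`; `(1+T)^{−er}M` is `ι`-fixed), and every
NONZERO solution of `ι M = w·(1+T)^e·M` is **`M = (1+T)^{−e/2}·S^{r₀}·N(Z)` with `r₀ = ord_T M`, `N(0) = coeff_{r₀}-unit part ≠ 0`, `w = (−1)^{r₀}`**,
`N` unique — ALL the coefficient laws of the lineage (sub-leading law XI, parity V/XII, the «odd-index laws» (E1)–(E3) of P-28E and their
infinitely many successors) are the statement «`(1+T)^{e/2}·M` is even or odd in `S`»; (§69) the WEIERSTRASS form: `M = p^μ·P·U` with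
`(1+T)^d ιP = wP` (Part XVI) forces `ι U = (1+T)^{e+d} U`, so **`U = (1+T)^{−(e+d)/2}·E(Z)`, `E(0) ∈ ℤ_pˣ`**; (§70) on the quadratic branch,
for every NONZERO `L_p^±(V, η, X)` (any period ratio; rows; `w = σ(−N|p) = w_V(−N_V|p)`): `L = (1+T)^{−(c+b)/2}·S^{ord L}·N(Z)` and
`L = p^{μ}·P·(1+T)^{−(c+b+λ)/2}·E(Z)`.

WHAT. §67 **`exists_unique_even_add_sqrtZ_mul_even`**; §68 `binomialSeries_natCast_mul_eq_pow`, `binomialSeries_mul_binomialSeries_neg`,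
**`exists_eq_binomialSeries_mul_subst_of_invol_eq`** (sign `+1`, any `M`), `constantCoeff_eq_of_eq_binomialSeries_mul_subst`,
**`exists_normCoordinate_of_invol_eq`** (`M ≠ 0`, sign `w`: `M = (1+T)^{er} S^{r₀} N(Z)`, `N(0) ≠ 0`, `w = (−1)^{r₀}`), `normCoordinate_unique`;
§69 **`exists_weierstrass_normCoordinate_of_invol_eq`**; §70 `exists_normCoordinate_of_isQuadraticBranch{Plus,Minus}LFunction`,
`exists_weierstrass_normCoordinate_of_isQuadraticBranch{Plus,Minus}LFunction`, `exists_normCoordinate_{plus,minus}_row`.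

HONEST FRAMING (cell `bsd-potss`; FULL-BSD rank ≤ 1 programme, HUMAN RULING D-0036/D-0074): TOOL THEOREMS ONLY — no definition (the
elements `S`, `Z` enter through the hypotheses `hS : S = X * binomialSeries ℤ_[p] r`, `2r = −1`, `hZ : Z = X + invol p X`), no named fact
(the Fricke sign and the `p`-adic exponent of the level are hypotheses discharged by tree theorems, as in Parts IX–XII), no `sorry`, axioms
standard; nothing about (A), (C1⁺_η), C-cc-1 or `BSD(W,p)` of any pair is claimed; no stub of 19606 is proved; crux and route OPEN;
nothing booked. `--supports stmt-BirchSwinnertonDyer-19606`.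

References: [Washington1997] §7.1, §13.2; [MazurTateTeitelbaum1986Invent] §I.17; [Sprung2017] Cor. 4.14; [BianchiSprung2019] Thm. 5.1
(`b = −(a/2)(log_γ N − 1/(p+1) + m)`: the `T`-linear instance of §68); [GreenbergLNM1716] §1 (pp. 67–68); [Pollack2003] Thm. 5.13. Tree: Parts X
(`invol_eq_of_isQuadraticBranch{Plus,Minus}LFunction`), XI (`invol_eq_binomialSeries_add_mul_of_X_pow_mul`), XVI (`exists_weierstrass_of_ne_zero`,
`one_add_X_pow_mul_invol_coe_eq_of_invol_eq`), XXIII; `Barriers/BirchSwinnertonDyer/PAdicFunctionalEquationParity` (`eq_neg_one_pow_of_subst_eq`).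
-/

set_option autoImplicit false
set_option linter.dupNamespace false
noncomputable section

open scoped Classical MatrixGroups ModularForm Topology

open PowerSeries CongruenceSubgroup Literature.NumberTheory.EllipticCurves Literature.NumberTheory.EllipticCurves.ModularForms
open Literature.NumberTheory.EllipticCurves.IwasawaAlgebra
open Summit.BirchSwinnertonDyer.Rank1Residual.Additive
open Summit.BirchSwinnertonDyer.Rank1Residual.X1.MuLambda (mu lam)

namespace Summit.BirchSwinnertonDyer.BirchSwinnertonDyer.Theorems.EtaThetaFunctionalEquation

variable {p : ℕ} [hp : Fact p.Prime]

section NormCoordinate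

variable {r : ℤ_[p]} {S Z : IwasawaAlgebra p}

/-! ## §67 The decomposition `Λ = ℤ_p⟦Z⟧ ⊕ S·ℤ_p⟦Z⟧` -/

/-- **`Λ = ℤ_p⟦Z⟧ ⊕ S·ℤ_p⟦Z⟧`** (`Z = T + ιT`, `S = T(1+T)^r`, `2r = −1`): every `f ∈ Λ` is `A(Z) + S·B(Z)` for a UNIQUE pair `(A, B)` —
existence: `f + ιf` is invariant, `f − ιf` anti-invariant, and `1/2 = −r ∈ ℤ_p`; uniqueness: apply `ι`, add and subtract (`Λ` is a domain,
`2 ≠ 0`, `S ≠ 0`, `H ↦ H(Z)` injective). [cite: Washington1997, §7.1 and §13.2] -/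
theorem exists_unique_even_add_sqrtZ_mul_even (hr : 2 * r = -1) (hS : S = X * binomialSeries ℤ_[p] r) (hZ : Z = X + invol p X)
    (f : IwasawaAlgebra p) :
    ∃! AB : IwasawaAlgebra p × IwasawaAlgebra p,
      f = PowerSeries.subst Z AB.1 + S * PowerSeries.subst Z AB.2 := by
  have hZ' := hasSubst_trace hZ
  obtain ⟨A, hA⟩ := (invol_eq_self_iff_exists_subst hr hS hZ (f + invol p f)).mp (by rw [map_add, invol_invol, add_comm])
  obtain ⟨B, hB⟩ := (invol_eq_neg_iff_exists_sqrtZ_mul_subst hr hS hZ (f - invol p f)).mp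
    (by rw [map_sub, invol_invol, neg_sub])
  have h2 : (C r : IwasawaAlgebra p) * 2 = -1 := by
    rw [mul_comm, ← map_ofNat C 2, ← map_mul, hr, map_neg, map_one]
  refine ⟨(C (-r) * A, C (-r) * B), ?_, ?_⟩
  · show f = PowerSeries.subst Z (C (-r) * A) + S * PowerSeries.subst Z (C (-r) * B)
    rw [subst_C_mul hZ', subst_C_mul hZ', ← hA, mul_left_comm, ← hB, ← mul_add, map_neg]
    linear_combination f * h2
  · rintro ⟨A', B'⟩ hf
    simp only at hf
    have hι : invol p f = PowerSeries.subst Z A' - S * PowerSeries.subst Z B' := by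
      rw [hf, map_add, invol_subst_trace hZ, invol_sqrtZ_mul_subst_trace hr hS hZ, ← sub_eq_add_neg]
    have hA' : f + invol p f = PowerSeries.subst Z (C 2 * A') := by
      rw [subst_C_mul hZ', map_ofNat]
      linear_combination hf + hι
    have hB' : f - invol p f = S * PowerSeries.subst Z (C 2 * B') := by
      rw [subst_C_mul hZ', map_ofNat]
      linear_combination hf - hι
    have eA : A = C 2 * A' := subst_trace_injective hZ (hA.symm.trans hA')
    have eB : B = C 2 * B' := subst_trace_injective hZ (mul_left_cancel₀ (sqrtZ_ne_zero hS) (hB.symm.trans hB'))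
    have h1 : (C (-r) : IwasawaAlgebra p) * C 2 = 1 := by
      rw [← map_mul, show (-r) * 2 = (1 : ℤ_[p]) by linear_combination -hr, map_one]
    ext1 <;> simp only [eA, eB, ← mul_assoc, h1, one_mul]

/-! ## §68 Every solution of `ι M = w·(1+T)^e·M` in the norm coordinate -/

/-- `(1+T)^{n·r} = ((1+T)^r)^n` for `n ∈ ℕ`. [folklore] -/
theorem binomialSeries_natCast_mul_eq_pow (n : ℕ) (r : ℤ_[p]) :
    binomialSeries ℤ_[p] ((n : ℤ_[p]) * r) = binomialSeries ℤ_[p] r ^ n := by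
  induction n with
  | zero => rw [Nat.cast_zero, zero_mul, binomialSeries_zero, pow_zero]
  | succ n ih => rw [Nat.cast_succ, add_mul, one_mul, binomialSeries_add, ih, pow_succ]

/-- `(1+T)^a · (1+T)^{−a} = 1`. [folklore] -/
theorem binomialSeries_mul_binomialSeries_neg (a : ℤ_[p]) :
    binomialSeries ℤ_[p] a * binomialSeries ℤ_[p] (-a) = 1 := by
  rw [← binomialSeries_add, add_neg_cancel, binomialSeries_zero]

/-- **Sign `+1`: every solution of `ι M = (1+T)^e·M` is `M = (1+T)^{er}·N(Z)`, `er = −e/2`** (`2r = −1`, `Z = T + ιT`): the series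
`(1+T)^{−er}·M` is `ι`-fixed (`ι((1+T)^{−er}) = (1+T)^{er}` and `er + e = −er`), hence a series in `Z` by Part XXIII. No hypothesis on `M`.
[cite: Washington1997, §13.2] [cite: MazurTateTeitelbaum1986Invent, §I.17] -/
theorem exists_eq_binomialSeries_mul_subst_of_invol_eq (hr : 2 * r = -1) (hS : S = X * binomialSeries ℤ_[p] r)
    (hZ : Z = X + invol p X) {M : IwasawaAlgebra p} {e : ℤ_[p]} (hFE : invol p M = binomialSeries ℤ_[p] e * M) :
    ∃ N : IwasawaAlgebra p, M = binomialSeries ℤ_[p] (e * r) * PowerSeries.subst Z N := by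
  have hfix : invol p (binomialSeries ℤ_[p] (-(e * r)) * M) = binomialSeries ℤ_[p] (-(e * r)) * M := by
    rw [map_mul, invol_binomialSeries, neg_neg, hFE, ← mul_assoc, ← binomialSeries_add,
      show e * r + e = -(e * r) by linear_combination e * hr]
  obtain ⟨N, hN⟩ := (invol_eq_self_iff_exists_subst hr hS hZ _).mp hfix
  refine ⟨N, ?_⟩
  rw [← hN, ← mul_assoc, binomialSeries_mul_binomialSeries_neg, one_mul]

/-- In `M = (1+T)^a·N(Z)` the constant terms agree: `N(0) = M(0)`. [folklore] -/
theorem constantCoeff_eq_of_eq_binomialSeries_mul_subst (hZ : Z = X + invol p X) {M N : IwasawaAlgebra p} {a : ℤ_[p]}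
    (h : M = binomialSeries ℤ_[p] a * PowerSeries.subst Z N) : constantCoeff N = constantCoeff M := by
  rw [h, map_mul, binomialSeries_constantCoeff, one_mul, constantCoeff_subst_trace hZ]

/-- **THE NORM-COORDINATE FORM OF A NONZERO SOLUTION OF `ι M = w·(1+T)^e·M`** (`w, e ∈ ℤ_p`, `Λ ∋ M ≠ 0`, `p` odd via `2r = −1`,
`S = T(1+T)^r`, `Z = T + ιT`): with `r₀ = ord_T M`,
**`M = (1+T)^{er} · S^{r₀} · N(Z)`, `N(0) ≠ 0`, and `w = (−1)^{r₀}`** (`(1+T)^{er} = (1+T)^{−e/2}`).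
Proof: `w = (−1)^{r₀}` (leading coefficients; the barrier lemma `eq_neg_one_pow_of_subst_eq`), `M = T^{r₀}Q`, `ι Q = (1+T)^{e+r₀}Q` (Part XI's
shift), `Q = (1+T)^{(e+r₀)r}N(Z)` (sign `+1` case) and `T^{r₀}(1+T)^{r₀ r} = S^{r₀}`. This is g28's «`M = (1+T)^{−e/2}D^rN(T²/(1+T))`».
[cite: MazurTateTeitelbaum1986Invent, §I.17] [cite: Sprung2017, Cor. 4.14] [cite: GreenbergLNM1716, §1 (pp. 67–68)] -/
theorem exists_normCoordinate_of_invol_eq (hr : 2 * r = -1) (hS : S = X * binomialSeries ℤ_[p] r) (hZ : Z = X + invol p X)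
    {M : IwasawaAlgebra p} (hM0 : M ≠ 0) {w e : ℤ_[p]} (hFE : invol p M = C w * binomialSeries ℤ_[p] e * M) :
    ∃ N : IwasawaAlgebra p, constantCoeff N ≠ 0 ∧ w = (-1) ^ (PowerSeries.order M).toNat ∧
      M = binomialSeries ℤ_[p] (e * r) * S ^ (PowerSeries.order M).toNat * PowerSeries.subst Z N := by
  set r₀ := (PowerSeries.order M).toNat with hr₀
  have hord : PowerSeries.order M = (r₀ : ℕ) := (coe_toNat_order hM0).symm
  have hw : w = (-1) ^ r₀ := by
    refine Literature.Barriers.BirchSwinnertonDyer.eq_neg_one_pow_of_subst_eq (constantCoeff_invSubOne p) (coeff_one_invSubOne p)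
      (binomialSeries_constantCoeff (A := ℤ_[p]) e) ?_ hord
    rw [← invol_apply]; exact hFE
  have hMQ : M = X ^ r₀ * divXPowOrder M := X_pow_order_mul_divXPowOrder.symm
  have hQ := invol_eq_binomialSeries_add_mul_of_X_pow_mul hFE hMQ hw
  obtain ⟨N, hN⟩ := exists_eq_binomialSeries_mul_subst_of_invol_eq hr hS hZ hQ
  refine ⟨N, ?_, hw, ?_⟩
  · rw [constantCoeff_eq_of_eq_binomialSeries_mul_subst hZ hN, constantCoeff_divXPowOrder]
    exact coeff_order hM0
  · rw [hS, mul_pow, ← binomialSeries_natCast_mul_eq_pow]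
    conv_lhs => rw [hMQ, hN]
    rw [add_mul, binomialSeries_add]
    ring

/-- **Uniqueness of the norm-coordinate datum**: `(1+T)^a·S^n·N(Z) = (1+T)^a·S^n·N'(Z)` forces `N = N'` (`Λ` a domain, `H ↦ H(Z)` injective).
[cite: Washington1997, §7.1] -/
theorem normCoordinate_unique (hS : S = X * binomialSeries ℤ_[p] r) (hZ : Z = X + invol p X) {a : ℤ_[p]} {n : ℕ}
    {N N' : IwasawaAlgebra p}
    (h : binomialSeries ℤ_[p] a * S ^ n * PowerSeries.subst Z N = binomialSeries ℤ_[p] a * S ^ n * PowerSeries.subst Z N') :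
    N = N' := by
  have hB : (binomialSeries ℤ_[p] a : IwasawaAlgebra p) ≠ 0 := fun h0 ↦ by
    simpa using congr_arg constantCoeff h0
  have hSn : S ^ n ≠ 0 := pow_ne_zero n (sqrtZ_ne_zero hS)
  exact subst_trace_injective hZ (mul_left_cancel₀ (mul_ne_zero hB hSn) h)

/-! ## §69 The Weierstrass form: `M = p^μ · P · (1+T)^{−(e+d)/2} · E(Z)`, `E(0) ∈ ℤ_pˣ` -/

/-- **THE UNIT OF A WEIERSTRASS DATUM IN THE NORM COORDINATE.** If `M = a·P·U` (`a ∈ ℤ_p ∖ {0}`, `P` distinguished of degree `d`,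
`U ∈ Λˣ`) satisfies `ι M = w·(1+T)^e·M`, then `(1+T)^d·ιP = w·P` (Part XVI), hence `ι U = (1+T)^{e+d}·U`, and so
**`U = (1+T)^{(e+d)r}·E(Z)` with `E(0) = U(0) ∈ ℤ_pˣ`** (`(e+d)r = −(e+d)/2`): **`M = a·P·(1+T)^{−(e+d)/2}·E(T + ιT)`**.
[cite: Washington1997, §7.1 (Thm. 7.3), §13.2] [cite: MazurTateTeitelbaum1986Invent, §I.17] -/
theorem exists_weierstrass_normCoordinate_of_invol_eq (hr : 2 * r = -1) (hS : S = X * binomialSeries ℤ_[p] r) (hZ : Z = X + invol p X)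
    {P : Polynomial ℤ_[p]} (hP : P.IsDistinguishedAt (IsLocalRing.maximalIdeal ℤ_[p])) {a : ℤ_[p]} (ha : a ≠ 0)
    {U : IwasawaAlgebra p} (hU : IsUnit U) {M : IwasawaAlgebra p} (hM : M = C a * (P : IwasawaAlgebra p) * U) {w e : ℤ_[p]}
    (hFE : invol p M = C w * binomialSeries ℤ_[p] e * M) :
    ∃ E : IwasawaAlgebra p, IsUnit (constantCoeff E) ∧
      U = binomialSeries ℤ_[p] ((e + P.natDegree) * r) * PowerSeries.subst Z E ∧
      M = C a * (P : IwasawaAlgebra p) * (binomialSeries ℤ_[p] ((e + P.natDegree) * r) * PowerSeries.subst Z E) := by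
  have hrec := one_add_X_pow_mul_invol_coe_eq_of_invol_eq hP ha hU hM hFE
  -- `M ≠ 0`, so `w ≠ 0`
  have hP0 : (P : IwasawaAlgebra p) ≠ 0 := fun h ↦ hP.monic.ne_zero (by exact_mod_cast h)
  have hM0 : M ≠ 0 := by
    rw [hM]
    exact mul_ne_zero (mul_ne_zero (fun h ↦ ha (by simpa using congr_arg constantCoeff h)) hP0) hU.ne_zero
  have hw0 : (C w : IwasawaAlgebra p) ≠ 0 := fun h ↦ by
    apply hM0
    apply invol_injective p
    rw [hFE, h, zero_mul, zero_mul, map_zero]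
  -- `ι U = (1+T)^{e+d} U`: multiply `ι M = w (1+T)^e M` by `(1+T)^d` and use `(1+T)^d ιP = wP`
  have hιU : invol p U = binomialSeries ℤ_[p] (e + P.natDegree) * U := by
    have h1 : (1 + X : IwasawaAlgebra p) ^ P.natDegree * invol p M =
        C a * (C w * (P : IwasawaAlgebra p)) * invol p U := by
      rw [hM, map_mul (invol p), map_mul (invol p), invol_C, ← hrec]; ring
    have h2 : (1 + X : IwasawaAlgebra p) ^ P.natDegree * invol p M =
        C a * (C w * (P : IwasawaAlgebra p)) * (binomialSeries ℤ_[p] (e + P.natDegree) * U) := by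
      rw [hFE, hM, binomialSeries_add, binomialSeries_nat]; ring
    have hne : C a * (C w * (P : IwasawaAlgebra p)) ≠ 0 :=
      mul_ne_zero (fun h ↦ ha (by simpa using congr_arg constantCoeff h)) (mul_ne_zero hw0 hP0)
    exact mul_left_cancel₀ hne (h1.symm.trans h2)
  obtain ⟨E, hE⟩ := exists_eq_binomialSeries_mul_subst_of_invol_eq hr hS hZ hιU
  refine ⟨E, ?_, hE, by rw [← hE]; exact hM⟩
  rw [constantCoeff_eq_of_eq_binomialSeries_mul_subst hZ hE, ← PowerSeries.isUnit_iff_constantCoeff]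
  exact hU

end NormCoordinate

/-! ## §70 On the quadratic branch: every nonzero `L_p^±(V, η, X)` in the norm coordinate -/

section Branch

variable {N : ℕ} [NeZero N] {f : CuspForm (Gamma0 N) 2} {r : ℤ_[p]} {S Z : IwasawaAlgebra p}

/-- **`L_p⁺(V, η, X) = (1+T)^{−(c+b)/2} · S^{ord L} · N(T + ιT)`, `N(0) ≠ 0`, `σ(−N|p) = (−1)^{ord L}`** — for `p` odd (`2r = −1`,
`S = T(1+T)^r`, `Z = T + ιT`), `f` a rational newform of level `N` prime to `p`, `a_p(f) = 0`, Fricke sign `σ`, `c` the `p`-adic exponent of `N`,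
`(p+1)b = −1`, ANY period ratio `ϖ` and every NONZERO plus branch function `L` (`IsQuadraticBranchPlusLFunction f p ϖ L`). Every coefficient law of
the lineage (sub-leading XI, parity V/XII, P-28E (E0)–(E3)) is an instance. [cite: Sprung2017, Cor. 4.14 (a_p = 0 display)]
[cite: MazurTateTeitelbaum1986Invent, §I.17] [cite: Kobayashi2003, Thm. 3.2, (3.4)] -/
theorem exists_normCoordinate_of_isQuadraticBranchPlusLFunction (hp2 : p ≠ 2) (hf0 : IsNewform0 f) (hQ : coeffField f = ⊥)
    (hpN : ¬ p ∣ N) (hap : cuspCoeff f p = ((0 : ℤ) : ℂ)) {σ : ℤ} (hσ : σ ^ 2 = 1)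
    (hW : atkinLehnerInvolution N 2 N f = (-(σ : ℂ)) • f)
    {ηN : rootsOfUnity (torsionOrder p) ℤ_[p]} {c : ℤ_[p]}
    (hc : ∀ n : ℕ, PadicInt.toZModPow (n + cyclotomicExponent p) ((ηN : ℤ_[p]ˣ) : ℤ_[p]) *
      (cyclotomicGenerator p : ZMod (p ^ (n + cyclotomicExponent p))) ^ (PadicInt.toZModPow n c).val =
        (N : ZMod (p ^ (n + cyclotomicExponent p))))
    {b : ℤ_[p]} (hb : ((p : ℤ_[p]) + 1) * b = -1)
    (hr : 2 * r = -1) (hS : S = X * binomialSeries ℤ_[p] r) (hZ : Z = X + invol p X)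
    {ϖ : ℚ} {L : IwasawaAlgebra p} (hL : IsQuadraticBranchPlusLFunction f p ϖ L) (hL0 : L ≠ 0) :
    ∃ Nn : IwasawaAlgebra p, constantCoeff Nn ≠ 0 ∧
      (((σ * legendreSym p (-(N : ℤ)) : ℤ) : ℤ_[p])) = (-1) ^ (PowerSeries.order L).toNat ∧
      L = binomialSeries ℤ_[p] ((c + b) * r) * S ^ (PowerSeries.order L).toNat * PowerSeries.subst Z Nn :=
  exists_normCoordinate_of_invol_eq hr hS hZ hL0 (invol_eq_of_isQuadraticBranchPlusLFunction hp2 hf0 hQ hpN hap hσ hW hc hb hL)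

/-- **`L_p⁻(V, η, X) = (1+T)^{−(c+a)/2} · S^{ord L} · N(T + ιT)`, `N(0) ≠ 0`, `σ(−N|p) = (−1)^{ord L}`** (minus twin, `(p+1)a = −p`).
[cite: Sprung2017, Cor. 4.14 (a_p = 0 display)] [cite: MazurTateTeitelbaum1986Invent, §I.17] [cite: Kobayashi2003, Thm. 3.2, (3.5)] -/
theorem exists_normCoordinate_of_isQuadraticBranchMinusLFunction (hp2 : p ≠ 2) (hf0 : IsNewform0 f) (hQ : coeffField f = ⊥)
    (hpN : ¬ p ∣ N) (hap : cuspCoeff f p = ((0 : ℤ) : ℂ)) {σ : ℤ} (hσ : σ ^ 2 = 1)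
    (hW : atkinLehnerInvolution N 2 N f = (-(σ : ℂ)) • f)
    {ηN : rootsOfUnity (torsionOrder p) ℤ_[p]} {c : ℤ_[p]}
    (hc : ∀ n : ℕ, PadicInt.toZModPow (n + cyclotomicExponent p) ((ηN : ℤ_[p]ˣ) : ℤ_[p]) *
      (cyclotomicGenerator p : ZMod (p ^ (n + cyclotomicExponent p))) ^ (PadicInt.toZModPow n c).val =
        (N : ZMod (p ^ (n + cyclotomicExponent p))))
    {a : ℤ_[p]} (ha : ((p : ℤ_[p]) + 1) * a = -(p : ℤ_[p]))
    (hr : 2 * r = -1) (hS : S = X * binomialSeries ℤ_[p] r) (hZ : Z = X + invol p X)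
    {ϖ : ℚ} {L : IwasawaAlgebra p} (hL : IsQuadraticBranchMinusLFunction f p ϖ L) (hL0 : L ≠ 0) :
    ∃ Nn : IwasawaAlgebra p, constantCoeff Nn ≠ 0 ∧
      (((σ * legendreSym p (-(N : ℤ)) : ℤ) : ℤ_[p])) = (-1) ^ (PowerSeries.order L).toNat ∧
      L = binomialSeries ℤ_[p] ((c + a) * r) * S ^ (PowerSeries.order L).toNat * PowerSeries.subst Z Nn :=
  exists_normCoordinate_of_invol_eq hr hS hZ hL0 (invol_eq_of_isQuadraticBranchMinusLFunction hp2 hf0 hQ hpN hap hσ hW hc ha hL)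

/-- **THE WEIERSTRASS / NORM-COORDINATE FORM OF `L_p⁺(V, η, X)`: `L = p^{μ(L)} · P · (1+T)^{(e+λ(L))r} · E(T + ιT)`, `P` distinguished of
degree `λ(L)`, `E(0) ∈ ℤ_pˣ`, `e` the exponent of the functional equation** (`p` odd, any period ratio, any NONZERO plus branch function).
[cite: Washington1997, §7.1 (Thm. 7.3), §13.2] [cite: Sprung2017, Cor. 4.14] [cite: MazurTateTeitelbaum1986Invent, §I.17] -/
theorem exists_weierstrass_normCoordinate_of_isQuadraticBranchPlusLFunction (hp2 : p ≠ 2) (hf0 : IsNewform0 f) (hQ : coeffField f = ⊥)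
    (hpN : ¬ p ∣ N) (hap : cuspCoeff f p = ((0 : ℤ) : ℂ))
    (hr : 2 * r = -1) (hS : S = X * binomialSeries ℤ_[p] r) (hZ : Z = X + invol p X)
    {ϖ : ℚ} {L : IwasawaAlgebra p} (hL : IsQuadraticBranchPlusLFunction f p ϖ L) (hL0 : L ≠ 0) :
    ∃ (e : ℤ_[p]) (P : Polynomial ℤ_[p]) (E : IwasawaAlgebra p), P.IsDistinguishedAt (IsLocalRing.maximalIdeal ℤ_[p]) ∧
      P.natDegree = lam L ∧ IsUnit (constantCoeff E) ∧
      L = C ((p : ℤ_[p]) ^ mu L) * (P : IwasawaAlgebra p) * (binomialSeries ℤ_[p] ((e + lam L) * r) * PowerSeries.subst Z E) := by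
  obtain ⟨σ, hσ, hW⟩ := exists_frickeSign_of_isNewform0 hf0
  obtain ⟨e, he⟩ := exists_invol_eq_of_isQuadraticBranchPlusLFunction hp2 hf0 hQ hpN hap hσ hW hL
  obtain ⟨P, U, hP, hU, hdeg, hLP⟩ := exists_weierstrass_of_ne_zero hL0
  have hpμ : ((p : ℤ_[p]) ^ mu L) ≠ 0 := pow_ne_zero _ (Nat.cast_ne_zero.mpr hp.out.ne_zero)
  obtain ⟨E, hE, -, hM⟩ := exists_weierstrass_normCoordinate_of_invol_eq hr hS hZ hP hpμ hU hLP he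
  exact ⟨e, P, E, hP, hdeg, hE, by rw [← hdeg]; exact hM⟩

/-- **THE WEIERSTRASS / NORM-COORDINATE FORM OF `L_p⁻(V, η, X)`** (minus twin). [cite: Washington1997, §7.1 (Thm. 7.3), §13.2]
[cite: Sprung2017, Cor. 4.14] [cite: MazurTateTeitelbaum1986Invent, §I.17] -/
theorem exists_weierstrass_normCoordinate_of_isQuadraticBranchMinusLFunction (hp2 : p ≠ 2) (hf0 : IsNewform0 f) (hQ : coeffField f = ⊥)
    (hpN : ¬ p ∣ N) (hap : cuspCoeff f p = ((0 : ℤ) : ℂ))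
    (hr : 2 * r = -1) (hS : S = X * binomialSeries ℤ_[p] r) (hZ : Z = X + invol p X)
    {ϖ : ℚ} {L : IwasawaAlgebra p} (hL : IsQuadraticBranchMinusLFunction f p ϖ L) (hL0 : L ≠ 0) :
    ∃ (e : ℤ_[p]) (P : Polynomial ℤ_[p]) (E : IwasawaAlgebra p), P.IsDistinguishedAt (IsLocalRing.maximalIdeal ℤ_[p]) ∧
      P.natDegree = lam L ∧ IsUnit (constantCoeff E) ∧
      L = C ((p : ℤ_[p]) ^ mu L) * (P : IwasawaAlgebra p) * (binomialSeries ℤ_[p] ((e + lam L) * r) * PowerSeries.subst Z E) := by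
  obtain ⟨σ, hσ, hW⟩ := exists_frickeSign_of_isNewform0 hf0
  obtain ⟨e, he⟩ := exists_invol_eq_of_isQuadraticBranchMinusLFunction hp2 hf0 hQ hpN hap hσ hW hL
  obtain ⟨P, U, hP, hU, hdeg, hLP⟩ := exists_weierstrass_of_ne_zero hL0
  have hpμ : ((p : ℤ_[p]) ^ mu L) ≠ 0 := pow_ne_zero _ (Nat.cast_ne_zero.mpr hp.out.ne_zero)
  obtain ⟨E, hE, -, hM⟩ := exists_weierstrass_normCoordinate_of_invol_eq hr hS hZ hP hpμ hU hLP he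
  exact ⟨e, P, E, hP, hdeg, hE, by rw [← hdeg]; exact hM⟩

/-- **AT A ROW (plus)**: `V` globally minimal, good at `p ≥ 5`, `a_p(V) = 0` (every row of crux 19606), `f` its newform with Fricke sign
`σ`, `c` the `p`-adic exponent of the level, `(p+1)b = −1`; then every NONZERO `Lη = L_p⁺(V, η, X)` (any period ratio) is
`(1+T)^{−(c+b)/2}·S^{ord Lη}·N(T + ιT)` with `N(0) ≠ 0` and `σ(−N|p) = (−1)^{ord Lη}`. [cite: Sprung2017, Cor. 4.14 (a_p = 0 display)]
[cite: MazurTateTeitelbaum1986Invent, §I.17] -/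
theorem exists_normCoordinate_plus_row (hp5 : 5 ≤ p) (V : WeierstrassCurve ℚ) [V.IsElliptic] [V.IsGloballyMinimal]
    (hgood : V.HasGoodReductionAtPrime p) (hap : V.frobeniusTrace p = 0) (hf : IsNewformOf V f) {σ : ℤ} (hσ : σ ^ 2 = 1)
    (hW : atkinLehnerInvolution N 2 N f = (-(σ : ℂ)) • f)
    {ηN : rootsOfUnity (torsionOrder p) ℤ_[p]} {c : ℤ_[p]}
    (hc : ∀ n : ℕ, PadicInt.toZModPow (n + cyclotomicExponent p) ((ηN : ℤ_[p]ˣ) : ℤ_[p]) *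
      (cyclotomicGenerator p : ZMod (p ^ (n + cyclotomicExponent p))) ^ (PadicInt.toZModPow n c).val =
        (N : ZMod (p ^ (n + cyclotomicExponent p))))
    {b : ℤ_[p]} (hb : ((p : ℤ_[p]) + 1) * b = -1)
    (hr : 2 * r = -1) (hS : S = X * binomialSeries ℤ_[p] r) (hZ : Z = X + invol p X)
    (ϖ : ℚ) {Lη : IwasawaAlgebra p} (hL : IsQuadraticBranchPlusLFunction f p ϖ Lη) (hL0 : Lη ≠ 0) :
    ∃ Nn : IwasawaAlgebra p, constantCoeff Nn ≠ 0 ∧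
      (((σ * legendreSym p (-(N : ℤ)) : ℤ) : ℤ_[p])) = (-1) ^ (PowerSeries.order Lη).toNat ∧
      Lη = binomialSeries ℤ_[p] ((c + b) * r) * S ^ (PowerSeries.order Lη).toNat * PowerSeries.subst Z Nn :=
  exists_normCoordinate_of_invol_eq hr hS hZ hL0 (invol_eq_plus_row hp5 V hgood hap hf hσ hW hc hb ϖ hL)

/-- **AT A ROW (minus)**: every NONZERO `L_p⁻(V, η, X)` of a row is `(1+T)^{−(c+a)/2}·S^{ord}·N(T + ιT)`, `N(0) ≠ 0`, `(p+1)a = −p`.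
[cite: Sprung2017, Cor. 4.14 (a_p = 0 display)] [cite: MazurTateTeitelbaum1986Invent, §I.17] -/
theorem exists_normCoordinate_minus_row (hp5 : 5 ≤ p) (V : WeierstrassCurve ℚ) [V.IsElliptic] [V.IsGloballyMinimal]
    (hgood : V.HasGoodReductionAtPrime p) (hap : V.frobeniusTrace p = 0) (hf : IsNewformOf V f) {σ : ℤ} (hσ : σ ^ 2 = 1)
    (hW : atkinLehnerInvolution N 2 N f = (-(σ : ℂ)) • f)
    {ηN : rootsOfUnity (torsionOrder p) ℤ_[p]} {c : ℤ_[p]}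
    (hc : ∀ n : ℕ, PadicInt.toZModPow (n + cyclotomicExponent p) ((ηN : ℤ_[p]ˣ) : ℤ_[p]) *
      (cyclotomicGenerator p : ZMod (p ^ (n + cyclotomicExponent p))) ^ (PadicInt.toZModPow n c).val =
        (N : ZMod (p ^ (n + cyclotomicExponent p))))
    {a : ℤ_[p]} (ha : ((p : ℤ_[p]) + 1) * a = -(p : ℤ_[p]))
    (hr : 2 * r = -1) (hS : S = X * binomialSeries ℤ_[p] r) (hZ : Z = X + invol p X)
    (ϖ : ℚ) {Lη : IwasawaAlgebra p} (hL : IsQuadraticBranchMinusLFunction f p ϖ Lη) (hL0 : Lη ≠ 0) :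
    ∃ Nn : IwasawaAlgebra p, constantCoeff Nn ≠ 0 ∧
      (((σ * legendreSym p (-(N : ℤ)) : ℤ) : ℤ_[p])) = (-1) ^ (PowerSeries.order Lη).toNat ∧
      Lη = binomialSeries ℤ_[p] ((c + a) * r) * S ^ (PowerSeries.order Lη).toNat * PowerSeries.subst Z Nn :=
  exists_normCoordinate_of_invol_eq hr hS hZ hL0 (invol_eq_minus_row hp5 V hgood hap hf hσ hW hc ha ϖ hL)

end Branch

end Summit.BirchSwinnertonDyer.BirchSwinnertonDyer.Theorems.EtaThetaFunctionalEquation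

end
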